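import Literature.AlgebraicGeometry.Motives.AbelianVarietyEndGaloisFinite
import Literature.AlgebraicGeometry.Motives.AbelianVarietyTorsionPointsAlgClosed
import Literature.AlgebraicGeometry.Motives.AbelianVarietyHomTorsionDetermined
import Literature.AlgebraicGeometry.Motives.AbelianVarietyBaseChangeTowerFst
import Literature.AlgebraicGeometry.Motives.ComplexAutGaloisDescent
import HarnessLib

/-!
# Complex Galois conjugation of endomorphisms of abelian varieties: rigidity over `K̄`, transfer along
# towers, and descent along `ℂ / K` (tools for Shimura 1998 §1.2 «every element of `Hom(A, B)` is defined
# over a separably algebraic extension of `k`»)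

Topic `Literature/AlgebraicGeometry/Motives`, namespace `Literature.AlgebraicGeometry.Motives.AbelianVariety`.
THEOREMS ONLY (no definition of a notion, no instance, no named fact; net Literature debt 0).  Written for
the cell `hodgecm-mathlib` (D-0151), row II-1-S9: the discharge of the named fact
`AbelianVariety.homDefinedOverFiniteExtension` (`Motives/AbelianVarietyHomFiniteExtension`) — this file is the
tool layer, `Motives/AbelianVarietyHomFiniteExtensionHolds` the assembly.

For an abelian variety `P` over a field `K ⊆ ℂ` of characteristic `0`, the group `Aut(ℂ/K)` acts on
`End(P ⊗_K ℂ)` by Galois conjugation `σ • r = galConj σ r` (`gal σ⁻¹ ≫ r ≫ gal σ` on schemes;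
`Motives/AbelianVarietyEndGaloisDescent`).  We prove:

* §1 **Rigidity over `K̄`** (`galConj_eq_self_of_forall_apply_algebraMap`): along any `K`-embedding
  `K̄ → ℂ`, an automorphism `σ ∈ Aut(ℂ/K)` FIXING `K̄` POINTWISE fixes every endomorphism of `P ⊗_K ℂ` — the
  two endomorphisms `σ • r`, `r` agree on all torsion points of `(P ⊗ ℂ)(ℂ)` (these are `K̄`-rational,
  `smul_eq_of_restricts_of_mem_torsionPoints`, and `(σ • r)(x) = σ • r(σ⁻¹ • x)`, `pointsEnd_galConj`), hence
  are equal (Milne 1986 Lemma 12.6 / Mumford §19 Thm. 3: `hom_eq_of_forall_torsionPoints`).  This is the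
  «`Hom_ℂ = Hom_{K̄}`» half of Shimura's sentence (Chow's rigidity), in the form «the `Aut(ℂ/K)`-action
  factors through `Gal(K̄/K)`»; `galConj_eq_galConj_of_forall_apply_algebraMap` is the two-automorphism form.
* §2 **Transfer along a tower** `k → k′ → S` (`gal_comp_toSchemeHom_baseChangeTowerIso_hom`,
  `galConj_baseChangeTowerIso_conj`): the tower isomorphism `(P ⊗_k k′) ⊗_{k′} S ≅ P ⊗_k S`
  (`baseChangeTowerIso`, Görtz–Wedhorn I Prop. 4.16) intertwines the Galois automorphisms `gal σ` of the two
  sides for `σ ∈ Aut(S/k′) ⊆ Aut(S/k)`, hence Galois conjugation.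
* §3 **Descent along `ℂ / K`** for `K` countable (`exists_baseChange_eq_of_forall_galConj_eq_complex`): an
  endomorphism of `P ⊗_K ℂ` fixed by every `σ ∈ Aut(ℂ/K)` is `r₀ ⊗ ℂ` for a unique `r₀ ∈ End_K(P)` —
  [Milne2005ShimuraVarieties] Prop. 13.1 (the tree's `GaloisDescent.existsUnique_map_eq_complex`, faithfully
  flat descent along `pr : P_ℂ → P` with the cocycle condition from the density of the twisted diagonals)
  packaged as a HOMOMORPHISM exactly as `AbelianVariety.descent` of `Motives/AbelianVarietyEndGaloisDescent`
  does for normal algebraic extensions (unit and multiplication axioms are checked after the faithful monoidal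
  base change).

## References
* [Shimura1998] G. Shimura, *Abelian Varieties with Complex Multiplication and Modular Functions* (1998), Ch. I
  §1.2 (p. 4): «every element of `Hom(A, B)` is defined over a separably algebraic extension of `k`».
* [Milne2005ShimuraVarieties] J. S. Milne, *Introduction to Shimura Varieties* (2005/2017), Prop. 13.1 p. 117.
* [Milne1986AbelianVarieties] J. S. Milne, *Abelian Varieties* (1986), §12 Lemma 12.6; §16.
* [MumfordAV1970] D. Mumford, *Abelian Varieties* (1970), §19 Thm. 3 and Cor. 1 (p. 176).
* [GortzWedhorn2020] U. Görtz, T. Wedhorn, *Algebraic Geometry I* (2nd ed.), Prop. 4.16, §(14.20), Thm. 14.72 (1).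
-/

noncomputable section

open CategoryTheory CategoryTheory.Limits AlgebraicGeometry MonoidalCategory CartesianMonoidalCategory

namespace Literature.AlgebraicGeometry.Motives

namespace AbelianVariety

open scoped MonObj Obj

set_option backward.isDefEq.respectTransparency false

/-! ## §1 Rigidity: `Aut(ℂ/K̄)` fixes every endomorphism of `P ⊗_K ℂ` -/

section Rigidity

variable {K : Type} [Field K] [CharZero K] [Algebra K ℂ] [Algebra (AlgebraicClosure K) ℂ]
  [IsScalarTower K (AlgebraicClosure K) ℂ] (P : AbelianVariety K)

/-- **An automorphism of `ℂ` over `K` fixing `K̄ ⊆ ℂ` pointwise fixes every endomorphism of `P ⊗_K ℂ`**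
(`K ⊆ ℂ` of characteristic `0`, `K̄ → ℂ` any `K`-embedding).  Proof: `σ • r` and `r` agree on every
torsion point `x_ℂ` of `(P ⊗ ℂ)(ℂ)` — `(σ • r)(x) = σ • r(σ⁻¹ • x)` (`pointsEnd_galConj`) and the torsion points
`x`, `r(x)` of `P(ℂ)` come from `P(K̄)`, so are fixed by `σ` (`smul_eq_of_restricts_of_mem_torsionPoints`) — and
homomorphisms of complex abelian varieties agreeing on all torsion points are equal
(`hom_eq_of_forall_torsionPoints`, Milne 1986 Lemma 12.6 / Mumford §19 Thm. 3).  This is «`Hom_ℂ = Hom_{K̄}`»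
(Shimura 1998 §1.2) in the form: the `Aut(ℂ/K)`-action on `End(P ⊗ ℂ)` factors through `Gal(K̄/K)`.
[cite: Shimura1998, Ch. I §1.2 (p. 4)] [cite: Milne1986AbelianVarieties, §12 Lemma 12.6] [cite: MumfordAV1970, §19 Thm. 3 and Cor. 1] -/
theorem galConj_eq_self_of_forall_apply_algebraMap (σ : ℂ ≃ₐ[K] ℂ)
    (hσ : ∀ x : AlgebraicClosure K,
      σ (algebraMap (AlgebraicClosure K) ℂ x) = algebraMap (AlgebraicClosure K) ℂ x)
    (r : P.baseChange ℂ ⟶ P.baseChange ℂ) : P.galConj ℂ σ r = r := by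
  refine hom_eq_of_forall_torsionPoints _ _ fun n hn Q hQ => ?_
  set x : P.Points ℂ := (P.pointsMulEquiv ℂ).symm Q with hx_def
  have hQx : Q = P.pointsMulEquiv ℂ x := by rw [hx_def, MulEquiv.apply_symm_apply]
  have hx : x ∈ P.torsionPoints ℂ n := by
    rw [mem_torsionPoints_iff] at hQ ⊢
    rw [hx_def, ← map_zpow, hQ, map_one]
  have hnK : ((n : ℤ) : K) ≠ 0 := by exact_mod_cast hn.ne'
  have hfix : ∀ y ∈ P.torsionPoints ℂ (n : ℤ), σ • y = y := fun y hy =>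
    P.smul_eq_of_restricts_of_mem_torsionPoints ℂ hnK σ 1
      (fun z => by rw [AlgEquiv.one_apply]; exact hσ z) hy (fun Q _ => one_smul _ Q)
  have h1 : ∀ s : P.baseChange ℂ ⟶ P.baseChange ℂ,
      Q ≫ s.hom.hom.hom = P.pointsMulEquiv ℂ (P.pointsEnd ℂ s x) := by
    intro s
    change _ = P.pointsMulEquiv ℂ ((P.pointsMulEquiv ℂ).symm (P.pointsMulEquiv ℂ x ≫ _))
    rw [MulEquiv.apply_symm_apply, hQx]
  rw [h1, h1, pointsEnd_galConj]
  have hσinv : σ⁻¹ • x = x := by rw [inv_smul_eq_iff, hfix x hx]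
  rw [hσinv, hfix _ (P.pointsEnd_mem_torsionPoints ℂ r hx)]

/-- **Two automorphisms of `ℂ` over `K` with the same restriction to `K̄` conjugate endomorphisms of `P ⊗_K ℂ`
identically**: `σ • r = τ • r` if `σ|_{K̄} = τ|_{K̄}` (§1 applied to `τ⁻¹σ`). [cite: Shimura1998, Ch. I §1.2 (p. 4)]
[cite: Milne1986AbelianVarieties, §12 Lemma 12.6] -/
theorem galConj_eq_galConj_of_forall_apply_algebraMap (σ τ : ℂ ≃ₐ[K] ℂ)
    (h : ∀ x : AlgebraicClosure K,
      σ (algebraMap (AlgebraicClosure K) ℂ x) = τ (algebraMap (AlgebraicClosure K) ℂ x))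
    (r : P.baseChange ℂ ⟶ P.baseChange ℂ) : P.galConj ℂ σ r = P.galConj ℂ τ r := by
  have hστ : σ = τ * (τ⁻¹ * σ) := by rw [mul_inv_cancel_left]
  have hfix : ∀ x : AlgebraicClosure K,
      (τ⁻¹ * σ) (algebraMap (AlgebraicClosure K) ℂ x) = algebraMap (AlgebraicClosure K) ℂ x := by
    intro x
    rw [AlgEquiv.mul_apply, h x]
    exact τ.symm_apply_apply _
  rw [hστ, galConj_mul, P.galConj_eq_self_of_forall_apply_algebraMap (τ⁻¹ * σ) hfix r]

end Rigidity

/-! ## §2 Galois conjugation along the tower `(P ⊗_k k′) ⊗_{k′} S ≅ P ⊗_k S` -/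

section Tower

variable {k k' S : Type} [Field k] [Field k'] [Field S] [Algebra k k'] [Algebra k' S] [Algebra k S]
  [IsScalarTower k k' S] (P : AbelianVariety k)

/-- The inverse of an automorphism restricts scalars to the inverse (both are `σ.symm`); private plumbing. [folklore] -/
private theorem restrictScalars_inv' (σ : S ≃ₐ[k'] S) :
    (σ.restrictScalars k)⁻¹ = (σ⁻¹).restrictScalars k :=
  AlgEquiv.ext fun _ => rfl

/-- **The tower isomorphism intertwines the Galois automorphisms**: for `σ ∈ Aut(S/k′)`, on schemes
`gal_{P ⊗ k′} σ ≫ e_P = e_P ≫ gal_P σ` where `e_P : (P ⊗_k k′) ⊗_{k′} S ≅ P ⊗_k S` and on the right `σ` is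
viewed in `Aut(S/k)` (both automorphisms are `1 × Spec σ⁻¹`; checked against the two projections, using
`e_P ≫ pr_P = pr ≫ pr`). [cite: GortzWedhorn2020, Prop. 4.16 and §(14.20)] -/
@[reassoc]
theorem gal_comp_toSchemeHom_baseChangeTowerIso_hom (σ : S ≃ₐ[k'] S) :
    (P.baseChange k').gal S σ ≫ Hom.toSchemeHom (baseChangeTowerIso k k' S P).hom =
      Hom.toSchemeHom (baseChangeTowerIso k k' S P).hom ≫ P.gal S (σ.restrictScalars k) := by
  have hw : Hom.toSchemeHom (baseChangeTowerIso k k' S P).hom ≫ pullback.snd P.X.hom (bcSpec k S) =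
      pullback.snd (P.baseChange k').X.hom (bcSpec k' S) :=
    Over.w (baseChangeTowerIso k k' S P).hom.hom.hom.hom
  apply pullback.hom_ext
  · rw [Category.assoc, Category.assoc, toSchemeHom_baseChangeTowerIso_hom_comp_fst, gal_fst,
      gal_fst_assoc, toSchemeHom_baseChangeTowerIso_hom_comp_fst]
  · rw [Category.assoc, Category.assoc, hw, gal_snd, gal_snd, reassoc_of% hw,
      restrictScalars_inv']
    rfl

/-- … and for the inverse isomorphism: `e_P⁻¹ ≫ gal_{P ⊗ k′} σ = gal_P σ ≫ e_P⁻¹`. [cite: GortzWedhorn2020, Prop. 4.16 and §(14.20)] -/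
@[reassoc]
theorem toSchemeHom_baseChangeTowerIso_inv_comp_gal (σ : S ≃ₐ[k'] S) :
    Hom.toSchemeHom (baseChangeTowerIso k k' S P).inv ≫ (P.baseChange k').gal S σ =
      P.gal S (σ.restrictScalars k) ≫ Hom.toSchemeHom (baseChangeTowerIso k k' S P).inv := by
  have hhi : Hom.toSchemeHom (baseChangeTowerIso k k' S P).hom ≫
      Hom.toSchemeHom (baseChangeTowerIso k k' S P).inv = 𝟙 _ := by
    rw [← toSchemeHom_comp, Iso.hom_inv_id]; rfl
  have hih : Hom.toSchemeHom (baseChangeTowerIso k k' S P).inv ≫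
      Hom.toSchemeHom (baseChangeTowerIso k k' S P).hom = 𝟙 _ := by
    rw [← toSchemeHom_comp, Iso.inv_hom_id]; rfl
  let Tl : ((P.baseChange k').baseChange S).X.left ≅ (P.baseChange S).X.left :=
    ⟨Hom.toSchemeHom (baseChangeTowerIso k k' S P).hom, Hom.toSchemeHom (baseChangeTowerIso k k' S P).inv,
      hhi, hih⟩
  change Tl.inv ≫ _ = _ ≫ Tl.inv
  rw [Iso.inv_comp_eq, ← Category.assoc, Iso.eq_comp_inv]
  exact P.gal_comp_toSchemeHom_baseChangeTowerIso_hom σ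

/-- **Galois conjugation commutes with the tower isomorphism**: conjugating `e_P ≫ r ≫ e_P⁻¹ ∈ End((P ⊗ k′) ⊗ S)`
by `σ ∈ Aut(S/k′)` is `e_P ≫ (σ • r) ≫ e_P⁻¹` with `σ • r` the conjugation of `r ∈ End(P ⊗_k S)` by `σ` viewed in
`Aut(S/k)`. [cite: GortzWedhorn2020, Prop. 4.16 and §(14.20)] -/
theorem galConj_baseChangeTowerIso_conj (σ : S ≃ₐ[k'] S) (r : P.baseChange S ⟶ P.baseChange S) :
    (P.baseChange k').galConj S σ
        ((baseChangeTowerIso k k' S P).hom ≫ r ≫ (baseChangeTowerIso k k' S P).inv) =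
      (baseChangeTowerIso k k' S P).hom ≫ P.galConj S (σ.restrictScalars k) r ≫
        (baseChangeTowerIso k k' S P).inv := by
  apply hom_ext_toSchemeHom
  rw [toSchemeHom_galConj, toSchemeHom_comp, toSchemeHom_comp, toSchemeHom_comp, toSchemeHom_comp,
    toSchemeHom_galConj]
  simp only [Category.assoc]
  rw [gal_comp_toSchemeHom_baseChangeTowerIso_hom_assoc, toSchemeHom_baseChangeTowerIso_inv_comp_gal,
    restrictScalars_inv']

end Tower

/-! ## §3 Descent of `Aut(ℂ/K)`-fixed endomorphisms along `ℂ / K` for `K` countable -/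

section ComplexDescent

open Cardinal

variable {K : Type} [Field K] [Algebra K ℂ] (P : AbelianVariety K)

/-- **An endomorphism of `P ⊗_K ℂ` fixed by `Aut(ℂ/K)` descends to `K`** (`K ⊆ ℂ` countable): if `σ • r = r`
for every `σ ∈ Aut(ℂ/K)` then `r = r₀ ⊗ ℂ` for some `r₀ ∈ End_K(P)` — [Milne2005ShimuraVarieties] Prop. 13.1
(«a regular map `V_Ω → W_Ω` commuting with the actions of `Aut(Ω/k)` … arises from a unique regular map `V → W`»;
the tree's `GaloisDescent.existsUnique_map_eq_complex`: `P_ℂ` is reduced — smooth over `ℂ` — and `P` is separated),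
the descended scheme morphism being a homomorphism because its base change is (faithfulness of the monoidal base
change, as in `AbelianVariety.descent`).  The descent `r₀` is unique (`Hom.baseChange_injective`).
[cite: Milne2005ShimuraVarieties, §13 Prop. 13.1 p. 117] [cite: GortzWedhorn2020, Thm. 14.72 (1)] -/
theorem exists_baseChange_eq_of_forall_galConj_eq_complex (hK : #K ≤ ℵ₀)
    (r : P.baseChange ℂ ⟶ P.baseChange ℂ) (hr : ∀ σ : ℂ ≃ₐ[K] ℂ, P.galConj ℂ σ r = r) :
    ∃ r₀ : P ⟶ P, Hom.baseChange ℂ r₀ = r := by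
  have hgal : ∀ σ : ℂ ≃ₐ[K] ℂ, P.gal ℂ σ ≫ Hom.toSchemeHom r = Hom.toSchemeHom r ≫ P.gal ℂ σ :=
    fun σ => P.gal_comp_toSchemeHom_of_galConj_eq ℂ σ r (hr σ)
  haveI : Smooth (P.baseChange ℂ).X.hom := (P.baseChange ℂ).smooth_hom
  haveI : IsReduced (GaloisDescent.bc ℂ P.X) := isReduced_of_smooth_over_field (P.baseChange ℂ).X.hom
  obtain ⟨f₀, hf₀, -⟩ := GaloisDescent.existsUnique_map_eq_complex (X := P.X) (Y := P.X) hK r.hom.hom.hom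
    (fun σ => by rw [← P.gal_eq_gal ℂ σ]; exact hgal σ)
  -- the descended morphism respects unit and multiplication: check after the faithful monoidal base change
  have hone : η[P.X] ≫ f₀ = η[P.X] := by
    refine bcFunctor_map_injective ℂ ?_
    rw [Functor.map_comp, hf₀, ← cancel_epi (Functor.LaxMonoidal.ε (bcFunctor K ℂ)),
      ← Functor.obj.η_def_assoc, ← Functor.obj.η_def]
    exact IsMonHom.one_hom (f := r.hom.hom.hom)
  have hmul : μ[P.X] ≫ f₀ = (f₀ ⊗ₘ f₀) ≫ μ[P.X] := by
    refine bcFunctor_map_injective ℂ ?_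
    rw [Functor.map_comp, Functor.map_comp, hf₀,
      ← cancel_epi (Functor.LaxMonoidal.μ (bcFunctor K ℂ) P.X P.X), ← Functor.obj.μ_def_assoc,
      ← Functor.LaxMonoidal.μ_natural_assoc, hf₀, ← Functor.obj.μ_def]
    exact IsMonHom.mul_hom (f := r.hom.hom.hom)
  refine ⟨InducedCategory.homMk (Grp.homMk'' (A := P.toGrp) (B := P.toGrp) f₀ hone hmul), ?_⟩
  apply AbelianVariety.hom_ext
  rw [Hom.baseChange_hom_hom_hom]
  exact hf₀

end ComplexDescent

/-! ## §4 Chow rigidity: endomorphisms of `P ⊗_k ℂ` for `k ⊆ ℂ` algebraically closed and countable (e.g. `k = ℚ̄`) -/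

section AlgClosed

open Cardinal

/-- **Every endomorphism of `P ⊗_k ℂ` is defined over `k`, for `k ⊆ ℂ` ALGEBRAICALLY CLOSED and countable** (e.g. `k = ℚ̄`):
`End_k(P) → End_ℂ(P ⊗_k ℂ)`, `r₀ ↦ r₀ ⊗ ℂ`, is onto (it is injective by `Hom.baseChange_injective`) — Shimura 1998 §1.2 «`Hom_ℂ = Hom_{k̄}`»
(Chow's rigidity), here from §1 and §3: every `σ ∈ Aut(ℂ/k)` fixes `k̄ = k` (an algebraic closure of an algebraically closed field is the
field itself, Mathlib `IsAlgClosed.algebraMap_bijective_of_isIntegral`), hence fixes every endomorphism, which therefore descends.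
(Appended 2026-08-28, cell `hodgecm-mathlib`; net debt 0.) [cite: Shimura1998, Ch. I §1.2 (p. 4)] [cite: Milne2005ShimuraVarieties, §13 Prop. 13.1 p. 117] -/
theorem exists_baseChange_eq_complex_of_isAlgClosed {k : Type} [Field k] [IsAlgClosed k] [CharZero k] [Algebra k ℂ]
    (hk : #k ≤ ℵ₀) (P : AbelianVariety k) (r : P.baseChange ℂ ⟶ P.baseChange ℂ) :
    ∃ r₀ : P ⟶ P, Hom.baseChange ℂ r₀ = r := by
  let e : AlgebraicClosure k →ₐ[k] ℂ := IsAlgClosed.lift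
  letI : Algebra (AlgebraicClosure k) ℂ := e.toRingHom.toAlgebra
  haveI : IsScalarTower k (AlgebraicClosure k) ℂ := IsScalarTower.of_algebraMap_eq fun x ↦ (e.commutes x).symm
  refine P.exists_baseChange_eq_of_forall_galConj_eq_complex hk r fun σ ↦
    P.galConj_eq_self_of_forall_apply_algebraMap σ (fun x ↦ ?_) r
  obtain ⟨y, rfl⟩ := (IsAlgClosed.algebraMap_bijective_of_isIntegral (k := k) (K := AlgebraicClosure k)).2 x
  rw [← IsScalarTower.algebraMap_apply, AlgEquiv.commutes]

end AlgClosed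

end AbelianVariety

end Literature.AlgebraicGeometry.Motives

end
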